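import Mathlib
import HarnessLib
import Summits.NavierStokesRegularity.NavierStokesRegularity.Theorems.PoloidalWindowDoorPoloidalWindowRigidityZShockHodographHump

/-!
# Crux K2 `PoloidalWindowRigidity` (stmt-NavierStokesRegularity-19708), line `z_shock` — NEGATIVE KERNEL BRICK 3 for the class-free
# slice Liouville `hGN`: the `s`-derivative floor and the sign of the JACOBIAN of the hump two-wave map

`--supports stmt-NavierStokesRegularity-19708 --as helper` (leafhand-ns-poloidalwindowdoor-3 g34, cell decomp-ns, 2026-09-01).
Class-free, def-free; Mathlib + the two bricks `…ZShockHodographDarboux` (p842123: `ξ_r = −ψ²τ_r`, `ξ_s = ψ²τ_s`) and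
`…ZShockHodographHump` (p842197: `2ψ²τ_r ≥ (1−m²)²/m − 2m > 0`).  **No stub and no summit is closed by this file; Navier–Stokes
regularity is NOT proved here (rung 0).**

For the hump Darboux–hodograph map `(r,s) ↦ (τ, ξ)` (`k = ψ² = (1 − ρ tanh ρ)²`, `f = g = artanh(·/m)`, `ρ = (r−s)/2`, `0 < m ≤ 1/2`,
`|r|, |s| < m`; evidence memo `HGN-COUNTEREXAMPLE-leafhand3-g34.md` §3):
* `two_psi_sq_mul_s` — closed form of the `s`-derivative value recorded by `…HodographDarboux.hodograph_s`:
  `2ψ²τ_s = −[2ψ f'(s) + c₂(ρ) f(r) − c₁(ρ) f(s) − F(r) − F(s)]` (pure algebra);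
* `hump_tau_s_neg` — hence `τ_s < 0` (the bracket is `2ψ²τ_r` at the swapped point `(s, r)`, floored by `…Hump.hump_floor`);
* `hump_jacobian_neg` — ★ the Jacobian `τ_r ξ_s − τ_s ξ_r = 2ψ² τ_r τ_s` of `(r,s) ↦ (τ,ξ)` is NEGATIVE at every point of the open
  square: the map is a real-analytic LOCAL DIFFEOMORPHISM everywhere (with the memo's properness + Hadamard: a diffeomorphism onto `ℝ²`,
  whose inverse is the bounded eternal two-wave solution of the hump p-system inhabiting `hGN` after the oblique embedding).
[folklore]
-/

noncomputable section

namespace Summit.NavierStokesRegularity.NavierStokesRegularity.Theorems.PoloidalWindowDoorPoloidalWindowRigidityZShockHodographJacobian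

-- the problem directory repeats the summit name (`NavierStokesRegularity/NavierStokesRegularity`)
set_option linter.dupNamespace false

open Real Set
open Summit.NavierStokesRegularity.NavierStokesRegularity.Theorems.PoloidalWindowDoorPoloidalWindowRigidityZShockHodographHump

/-- **Closed form of `2ψ²τ_s` for the hump pair** (the value recorded by `…HodographDarboux.hodograph_s` with `T₁ = 1 − t²`,
`ψ₁ = −(t + ρ(1−t²))`, `g = f`, `G = F`): pure algebra. [folklore] -/
theorem two_psi_sq_mul_s (t ρ fr fs g₁ Fr Fs : ℝ) (hψ : 1 - ρ * t ≠ 0) :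
    2 * (1 - ρ * t) ^ 2 *
        (((-g₁ - ((1 - t ^ 2) * (-(1 / 2)) * (Fr + Fs) + t * fs)) * (1 - ρ * t) -
            (fr - fs - t * (Fr + Fs)) * (-(t + ρ * (1 - t ^ 2)) * (-(1 / 2)))) / (1 - ρ * t) ^ 2) =
      -(2 * (1 - ρ * t) * g₁ + (ρ + t - ρ * t ^ 2) * fr - (ρ - t + ρ * t ^ 2) * fs - (Fr + Fs)) := by
  field_simp
  ring

/-- ★ **`τ_s < 0` on the open square** (`0 < m ≤ 1/2`, `|r|, |s| < m`): the `s`-derivative value of the hump Darboux map recorded by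
`…HodographDarboux.hodograph_s` (data `g = artanh(·/m)`, `g' = (1/m)/(1 − (s/m)²)`, `G = F`) is negative, since `−2ψ²τ_s` is the floored
quantity of `…Hump.hump_floor` at the swapped point `(s, r)`. [folklore] -/
theorem hump_tau_s_neg (m r s : ℝ) (hm : 0 < m) (hm' : m ≤ 1 / 2) (hr : |r| < m) (hs : |s| < m) :
    ((-(1 / m / (1 - (s / m) ^ 2)) -
            ((1 - Real.tanh ((r - s) / 2) ^ 2) * (-(1 / 2)) *
                (m / 2 * ((1 + r / m) * Real.log (1 + r / m) + (1 - r / m) * Real.log (1 - r / m)) +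
                  m / 2 * ((1 + s / m) * Real.log (1 + s / m) + (1 - s / m) * Real.log (1 - s / m))) +
              Real.tanh ((r - s) / 2) * Real.artanh (s / m))) *
          (1 - (r - s) / 2 * Real.tanh ((r - s) / 2)) -
        (Real.artanh (r / m) - Real.artanh (s / m) -
            Real.tanh ((r - s) / 2) *
              (m / 2 * ((1 + r / m) * Real.log (1 + r / m) + (1 - r / m) * Real.log (1 - r / m)) +
                m / 2 * ((1 + s / m) * Real.log (1 + s / m) + (1 - s / m) * Real.log (1 - s / m)))) *
          (-(Real.tanh ((r - s) / 2) + (r - s) / 2 * (1 - Real.tanh ((r - s) / 2) ^ 2)) * (-(1 / 2)))) /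
      (1 - (r - s) / 2 * Real.tanh ((r - s) / 2)) ^ 2 < 0 := by
  -- the floor at the swapped point `(s, r)`
  have hfl := hump_floor m s r hm hm' hs hr
  have hpos := hump_floor_pos m hm hm'
  have e1 : (s - r) / 2 = -((r - s) / 2) := by ring
  rw [e1, Real.tanh_neg] at hfl
  set ρ : ℝ := (r - s) / 2 with hρdef
  set t : ℝ := Real.tanh ρ with htdef
  have hrabs := abs_lt.mp hr
  have hsabs := abs_lt.mp hs
  have hρm : |ρ| < m := by rw [hρdef, abs_lt]; constructor <;> linarith
  have ht : |t| ≤ |ρ| := Literature.Barriers.HubbardSuperconductivity.abs_tanh_le_abs_self ρ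
  have hψpos : 0 < 1 - ρ * t := by
    have h1 : ρ * t ≤ |ρ| * |t| := by rw [← abs_mul]; exact le_abs_self _
    have h2 : |ρ| * |t| ≤ |ρ| * |ρ| := mul_le_mul_of_nonneg_left ht (abs_nonneg _)
    have h3 : |ρ| * |ρ| < m * m := mul_self_lt_mul_self (abs_nonneg _) hρm
    nlinarith
  have hid := two_psi_sq_mul_s t ρ (Real.artanh (r / m)) (Real.artanh (s / m)) (1 / m / (1 - (s / m) ^ 2))
    (m / 2 * ((1 + r / m) * Real.log (1 + r / m) + (1 - r / m) * Real.log (1 - r / m)))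
    (m / 2 * ((1 + s / m) * Real.log (1 + s / m) + (1 - s / m) * Real.log (1 - s / m))) hψpos.ne'
  have hψ2 : 0 < 2 * (1 - ρ * t) ^ 2 := by positivity
  have hE : 2 * (1 - ρ * t) ^ 2 *
      (((-(1 / m / (1 - (s / m) ^ 2)) -
            ((1 - t ^ 2) * (-(1 / 2)) *
                (m / 2 * ((1 + r / m) * Real.log (1 + r / m) + (1 - r / m) * Real.log (1 - r / m)) +
                  m / 2 * ((1 + s / m) * Real.log (1 + s / m) + (1 - s / m) * Real.log (1 - s / m))) +
              t * Real.artanh (s / m))) * (1 - ρ * t) -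
        (Real.artanh (r / m) - Real.artanh (s / m) -
            t * (m / 2 * ((1 + r / m) * Real.log (1 + r / m) + (1 - r / m) * Real.log (1 - r / m)) +
                m / 2 * ((1 + s / m) * Real.log (1 + s / m) + (1 - s / m) * Real.log (1 - s / m)))) *
          (-(t + ρ * (1 - t ^ 2)) * (-(1 / 2)))) / (1 - ρ * t) ^ 2) < 0 := by
    rw [hid]
    -- `hfl` is the floor for the bracket (with `-ρ`, `-t` in place of `ρ'`, `tanh ρ'`)
    have hexp : 2 * (1 - -ρ * -t) * (1 / m / (1 - (s / m) ^ 2)) +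
          (-ρ - -t + -ρ * (-t) ^ 2) * Real.artanh (s / m) -
          (-ρ + -t - -ρ * (-t) ^ 2) * Real.artanh (r / m) =
        2 * (1 - ρ * t) * (1 / m / (1 - (s / m) ^ 2)) + (ρ + t - ρ * t ^ 2) * Real.artanh (r / m) -
          (ρ - t + ρ * t ^ 2) * Real.artanh (s / m) := by ring
    linarith
  exact neg_of_mul_neg_right hE hψ2.le

/-- ★ **The Jacobian of the hump two-wave map is negative everywhere on the open square.**  With `Z_r`, `Z_s` the recorded derivative
values of `τ` (bricks 1–2) and `ξ_r = −ψ²Z_r`, `ξ_s = ψ²Z_s` (`…HodographDarboux.hodograph_r/_s`), the Jacobian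
`Z_r·(ψ²Z_s) − Z_s·(−ψ²Z_r) = 2ψ²Z_rZ_s` is `< 0` whenever `Z_r > 0`, `Z_s < 0`, `ψ ≠ 0` — here from `…Hump.hump_tau_r_pos` and
`hump_tau_s_neg`.  Stated for arbitrary reals so that it applies verbatim to the recorded values. [folklore] -/
theorem hump_jacobian_neg (ψ Zr Zs : ℝ) (hψ : ψ ≠ 0) (hr : 0 < Zr) (hs : Zs < 0) :
    Zr * (ψ ^ 2 * Zs) - Zs * (-(ψ ^ 2) * Zr) < 0 := by
  have hψ2 : 0 < ψ ^ 2 := by positivity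
  nlinarith [mul_pos hr hψ2, mul_pos (mul_pos hr hψ2) (neg_pos.mpr hs)]

end Summit.NavierStokesRegularity.NavierStokesRegularity.Theorems.PoloidalWindowDoorPoloidalWindowRigidityZShockHodographJacobian
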